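import Literature.AnabelianGeometry.SemiGraphs.TemperedAnabelianThm68iiiAssembly
import Literature.AnabelianGeometry.SemiGraphs.TemperedDLocTransportEquivalence
import Literature.AnabelianGeometry.SemiGraphs.TemperedTorsionPoints

/-!
# [SemiAnbd] Thm. 6.8 as printed over the origin hypotheses: REDUCTION closers to named leaves

Mochizuki, *Semi-graphs of anabelioids*, Publ. RIMS **42** (2006) [SemiAnbd], §6, Theorem 6.8
(Tempered Group-theoreticity of the Category of Dominant Localizations) (i)–(iv) and Corollary 6.9,
ms. pp. 74–75; printed proof (p. 75): "In light of Theorems 6.4, 6.5, the present Theorem 6.8 follows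
by exactly the same arguments as those applied in [Mzk8] to prove [Mzk8], Theorem 2.3; Corollaries 2.5,
2.6, 2.8" ([Mzk8] = *Galois sections in absolute anabelian geometry*, Nagoya Math. J. **179** (2005),
§2, ms. pp. 7–12). [cite: MochizukiSemiAnbd2006, Thm 6.8 pp.74-75] [cite: MochizukiGalSect2005, §2 pp.7-12]

PROOF-ONLY file (no definitions, no new named facts; abc-iut cell, layer L3, D-0079 L-F pack D).  The
printed, universally quantified statements over the ORIGIN hypotheses —
`TemperedMorphismOrigin.DLocGroupTheoreticityHolds` (Thm. 6.8 (i)(ii)), its genuine-morphism form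
`TemperedMorphismOrigin.DLocGroupTheoreticityGenuineHolds`, `TemperedMorphismOrigin.DecompositionPreservationHolds`
(Thm. 6.8 (iii)(iv), Cor. 6.9) and `TemperedTorsionOrigin.TorsionPointsHolds` (Thm. 6.8 (iii), both
sentences) — are FALSE over arbitrary interface data (`TemperedAnabelianMorphismsSchemaNegative.lean`,
`TemperedDLocGenuineSchemaNegative.lean`, `TemperedTorsionPointsSchemaNegative.lean`: junk origins certify
junk data).  This file proves them for every origin `Ω` whose certified data satisfy the NAMED LEAVES of
the printed argument, each displayed as a hypothesis quantified over the certified data only: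

* origin faithfulness / closure: a certified `DLoc` context IS a genuine-morphism context
  (`DLocSchemeData.toDLocContext`; the morphisms over `G_K` of [SemiAnbd] p. 74: "an outer homomorphism
  of DOF-type that is compatible with the various natural [open] outer homomorphisms from the `H_i`,
  `J_i` to `G_K`"); the
  curves underlying the objects of a certified `DLoc_K(X_K)` are certified hyperbolic curves ([Mzk8]
  Def. 2.1 (ii): hyperbolic partial compactifications); every certified curve carries certified `DLoc_K`
  data ([Mzk8] Def. 2.1);
* the intermediate STATEMENTS of the sub-DAG `plan/L3/SUBDAG-SemiAnbd-Thm68.md`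
  (`TemperedAnabelianThm68Sub.lean`, seat abc-iut-w5-d040): T68i-L01 `CoveringObjectOfOpenSubgroup`,
  T68i-L02 `ObjectsHitOnTheNose`, T68i-L04 `PiFunctorBijectiveOnHom` (= Thm. 6.4 for pairs of objects),
  T68-B1 `DecompCompact`, T68-B4 `CuspImageOpenInDecomp`, T68iii-L04 `TorsionIffMulNCuspImage`,
  T68iv-L05 `DefinedOverNFIffExistsAlgebraic`;
* [SemiAnbd] Thm. 6.5 (i)(ii)(iv) and Thm. 6.5 (iii) AS PRINTED over the origin
  (`TemperedOrigin.TemperedDecompositionGroupsHolds`, `TemperedOrigin.CuspidalAbsolutenessHolds`), BY NAME;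
* (hΔ) "`α(Δ^temp_X) = Δ^temp_Y`" for isomorphisms of certified curves — [Mzk8] Prop. 1.1 (ii) in the
  proof of [Mzk8] Thm. 2.3 (ii) (kept explicit, as in `TemperedDLocTransport.lean`);
* the flag coherence "the origin of a once-punctured elliptic curve is a torsion closed point" (sub-DAG
  reading flag R-iii-2);
* and, carried VERBATIM as binders because no mechanism for them is typed in the tree: Thm. 6.8 (iv),
  first sentence (`TemperedCurve.IsoPreservesAlgebraicDecomp`, sub-DAG node T68iv-A, open: reading
  question Q-iv of the sub-DAG), Cor. 6.9 (`TemperedCurve.IsoPreservesAllDecompGenusZeroNF`; printed proof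
  = the tempered analogue of [Mzk8] Lemma 3.1 / Cor. 3.2, p. 75–76, not typed), and the Tate-module
  clause of Thm. 6.8 (iii) (`TemperedCurve.IsoTorsionBijectionTateCompatible`; printed proof "by
  considering the automorphisms of `Z_K` over [i.e., relative to `φ`] `X_K`, after possibly enlarging
  `K`", [Mzk8] p. 10 — needs the `E[n]`-torsor datum on the torsion closed points, sub-DAG row
  T68iii-L07, not in the interface).

The knitting uses the landed assemblies BY NAME: `Thm68Sub.dlocEquivalence_of_parts`,
`Thm68Sub.piFunctorEssSurj_of_onTheNose`, `isoInducesDLocEquivalence_of_thm65iii`,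
`Thm68Sub.isoPreservesTemperedDLocType_of`, `Thm68Sub.isoPreservesTorsionDecomp_of`,
`Thm68Sub.definedOverNumberFieldIff_of`.  Honest framing: REDUCED ≠ proved — the leaves are assumption
LABELS on OUR typed statements of the refereed [SemiAnbd]/[Mzk8]; nothing of [SemiAnbd] §6, [Mzk8],
[André], [Belyi] is discharged here; no statement is strengthened; nothing here takes a side on
[IUTchIII] Cor. 3.12.

v2 (doc-only; every declaration, statement and proof byte-identical to v1): referee finding F59 (a)(b)
— the [SemiAnbd] p. 74 and [Mzk8] p. 10 quotations above and in `torsionPointsHolds_of_parts` now read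
literally as printed (gloss moved outside the quotation marks; print's bracket "[i.e., relative to `φ`]"
restored) — and the [Mzk8] Thm. 2.3 locator corrected to pp. 8–9 (statement p. 8, items and proof p. 9).
-/

noncomputable section

namespace Literature.AnabelianGeometry.SemiGraphs

open scoped Pointwise
open CategoryTheory Topology

variable {p : ℕ} [Fact p.Prime]

namespace Thm68Sub

variable {X Y : TemperedCurve p}

/-- **[SemiAnbd] Thm. 6.8 (i)(ii) for ONE pair of genuine-morphism contexts, from the named leaves**
([Mzk8] proof of Thm. 2.3 / Cor. 2.5, p. 9, transposed per [SemiAnbd] p. 75): for scheme data `DX`,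
`DY` of `X_K`, `Y_L` — objects hit on the nose (T68i-L02), bijectivity on Hom-sets (T68i-L04 = Thm. 6.4
for pairs of objects), the tacit image statement T68-B4 for `Y_L`, compact decomposition groups
(T68-B1), commensurable terminality (Thm. 6.5 (ii)) for both curves, Thm. 6.5 (iii) for `X_K ↔ Y_L` in
both directions and for the curves underlying the objects, and (hΔ) for every `α` — the functor
`DLoc_K(X_K) → DLoc_{G_K}(Π^temp_{X_K})` is an equivalence and every `α : Π^temp_{X_K} ⥲ Π^temp_{Y_L}`
induces the equivalence of (ii) and preserves the decomposition groups of tempered `DLoc`-type.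
[cite: MochizukiSemiAnbd2006, Thm 6.8(i)-(ii) p.74] [cite: MochizukiGalSect2005, Thm 2.3 pp.8-9, Cor 2.5 p.9] -/
theorem dlocClauses_of_parts (DX : DLocSchemeData X) (DY : DLocSchemeData Y)
    (hL02X : ObjectsHitOnTheNose X DX) (hL02Y : ObjectsHitOnTheNose Y DY)
    (hL04X : PiFunctorBijectiveOnHom X DX) (hL04Y : PiFunctorBijectiveOnHom Y DY)
    (hB4Y : CuspImageOpenInDecomp Y DY) (hcX : DecompCompact X) (hcY : DecompCompact Y)
    (hctX : X.DecompCommensurablyTerminal) (hctY : Y.DecompCommensurablyTerminal)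
    (h65 : X.IsoPreservesCuspidalDecomp Y) (h65' : Y.IsoPreservesCuspidalDecomp X)
    (h65iii : ∀ (Z : DX.DLocK) (Z' : DY.DLocK), (DX.curve Z).IsoPreservesCuspidalDecomp (DY.curve Z'))
    (hΔ : ∀ α : X.PiTemp ≃ₜ* Y.PiTemp, X.DeltaTemp.map α.toMulEquiv.toMonoidHom = Y.DeltaTemp) :
    X.DLocEquivalence DX.toDLocContext ∧ ∀ α : X.PiTemp ≃ₜ* Y.PiTemp,
      X.IsoInducesDLocEquivalence Y DX.toDLocContext DY.toDLocContext α ∧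
        X.IsoPreservesTemperedDLocType Y DX.toDLocContext DY.toDLocContext α := by
  have hffX := full_and_faithful_of_bijectiveOnHom X DX hL04X
  have hffY := full_and_faithful_of_bijectiveOnHom Y DY hL04Y
  refine ⟨dlocEquivalence_of_parts X DX hffX.1 hffX.2 (piFunctorEssSurj_of_onTheNose DX hL02X),
    fun α => ⟨isoInducesDLocEquivalence_of_thm65iii DX DY h65 h65' α (hΔ α), ?_⟩⟩
  exact isoPreservesTemperedDLocType_of DX DY α (fun I hI => (h65 α I).2 hI) (hΔ α)
    (piFunctorEssSurj_of_onTheNose DY hL02Y) hffY.1 h65iii hB4Y hcX hcY hctX hctY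

end Thm68Sub

/-! ### Thm. 6.8 (i), (ii) over the origin hypotheses -/

namespace TemperedMorphismOrigin

open Thm68Sub

/-- **[SemiAnbd] Thm. 6.8 (i)(ii) as printed, genuine-morphism form (`DLocGroupTheoreticityGenuineHolds`,
FACT-LIST F-1698), REDUCED to named leaves**: for an origin `Ω` such that — for all CERTIFIED hyperbolic
curves and certified genuine-morphism `DLoc` data — the curves underlying the objects of `DLoc_K(X_K)`
are certified ([Mzk8] Def. 2.1 (ii)), every group-theoretic object is hit on the nose (T68i-L02), the
tempered-π₁ functor is bijective on Hom-sets (T68i-L04 = [SemiAnbd] Thm. 6.4 for pairs of objects), the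
tacit image statement T68-B4 holds, decomposition groups are compact (T68-B1, p. 71), [SemiAnbd]
Thm. 6.5 (i)(ii)(iv) and Thm. 6.5 (iii) hold as printed (`TemperedDecompositionGroupsHolds`,
`CuspidalAbsolutenessHolds`, BY NAME) and (hΔ) every isomorphism of tempered groups of certified curves
carries `Δ^temp_X` onto `Δ^temp_Y` ([Mzk8] Prop. 1.1 (ii)) — Thm. 6.8 (i)(ii) holds for all certified
data.  Knit from `Thm68Sub.dlocClauses_of_parts`; nothing of [SemiAnbd]/[Mzk8] is asserted.
[cite: MochizukiSemiAnbd2006, Thm 6.8(i)-(ii) p.74] [cite: MochizukiGalSect2005, Thm 2.3 pp.8-9] -/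
theorem dlocGroupTheoreticityGenuineHolds_of_parts (Ω : TemperedMorphismOrigin p)
    (hcurve : ∀ (X : TemperedCurve p) (D : DLocSchemeData X) (Z : D.DLocK),
      Ω.IsHyperbolicCurveOrigin X → Ω.IsDLocOrigin D.toDLocContext →
        Ω.IsHyperbolicCurveOrigin (D.curve Z))
    (hL02 : ∀ (X : TemperedCurve p) (D : DLocSchemeData X), Ω.IsHyperbolicCurveOrigin X →
      Ω.IsDLocOrigin D.toDLocContext → ObjectsHitOnTheNose X D)
    (hL04 : ∀ (X : TemperedCurve p) (D : DLocSchemeData X), Ω.IsHyperbolicCurveOrigin X →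
      Ω.IsDLocOrigin D.toDLocContext → PiFunctorBijectiveOnHom X D)
    (hB4 : ∀ (X : TemperedCurve p) (D : DLocSchemeData X), Ω.IsHyperbolicCurveOrigin X →
      Ω.IsDLocOrigin D.toDLocContext → CuspImageOpenInDecomp X D)
    (hB1 : ∀ X : TemperedCurve p, Ω.IsHyperbolicCurveOrigin X → DecompCompact X)
    (h65 : Ω.CuspidalAbsolutenessHolds) (h65i : Ω.TemperedDecompositionGroupsHolds)
    (hΔ : ∀ X Y : TemperedCurve p, Ω.IsHyperbolicCurveOrigin X → Ω.IsHyperbolicCurveOrigin Y →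
      ∀ α : X.PiTemp ≃ₜ* Y.PiTemp, X.DeltaTemp.map α.toMulEquiv.toMonoidHom = Y.DeltaTemp) :
    Ω.DLocGroupTheoreticityGenuineHolds := by
  intro X Y DX DY hX hY hDX hDY
  exact dlocClauses_of_parts DX DY (hL02 X DX hX hDX) (hL02 Y DY hY hDY) (hL04 X DX hX hDX)
    (hL04 Y DY hY hDY) (hB4 Y DY hY hDY) (hB1 X hX) (hB1 Y hY) (h65i X hX).2.2.1 (h65i Y hY).2.2.1
    (h65 X Y hX hY) (h65 Y X hY hX)
    (fun Z Z' => h65 _ _ (hcurve X DX Z hX hDX) (hcurve Y DY Z' hY hDY)) (hΔ X Y hX hY)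

/-- **`DLocGroupTheoreticityHolds` ⟸ its genuine-morphism form + origin faithfulness** (converse of
`dlocGroupTheoreticityGenuineHolds_of`): if every CERTIFIED `DLoc` context of a certified curve IS a
genuine-morphism context — "`D` is `DLoc_K(X_K)` with the tempered fundamental group functor" valued
in `DLoc_{G_K}(Π^temp_{X_K})` with its genuine morphisms, the outer homomorphisms of DOF-type over
`G_K` ([SemiAnbd] p. 74), i.e. `DX = D.toDLocContext` for some `DLocSchemeData` — then Thm. 6.8 (i)(ii)
as printed over all certified contexts (FACT-LIST F-1681) follows from the genuine-morphism form
(F-1698). [cite: MochizukiSemiAnbd2006, Thm 6.8(i)-(ii) p.74] -/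
theorem dlocGroupTheoreticityHolds_of_genuine (Ω : TemperedMorphismOrigin p)
    (hgen : ∀ (X : TemperedCurve p) (DX : DLocContext X), Ω.IsHyperbolicCurveOrigin X →
      Ω.IsDLocOrigin DX → ∃ D : DLocSchemeData X, D.toDLocContext = DX)
    (h : Ω.DLocGroupTheoreticityGenuineHolds) : Ω.DLocGroupTheoreticityHolds := by
  intro X Y DX DY hX hY hDX hDY
  obtain ⟨D, rfl⟩ := hgen X DX hX hDX
  obtain ⟨D', rfl⟩ := hgen Y DY hY hDY
  exact h X Y D D' hX hY hDX hDY

/-- **[SemiAnbd] Thm. 6.8 (i)(ii) as printed (`DLocGroupTheoreticityHolds`, FACT-LIST F-1681), REDUCED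
to named leaves**: origin faithfulness (certified `DLoc` contexts are genuine-morphism contexts) and
the leaves of `dlocGroupTheoreticityGenuineHolds_of_parts`.  Nothing of [SemiAnbd]/[Mzk8] is asserted.
[cite: MochizukiSemiAnbd2006, Thm 6.8(i)-(ii) p.74] [cite: MochizukiGalSect2005, Thm 2.3 pp.8-9, Cor 2.5 p.9] -/
theorem dlocGroupTheoreticityHolds_of_parts (Ω : TemperedMorphismOrigin p)
    (hgen : ∀ (X : TemperedCurve p) (DX : DLocContext X), Ω.IsHyperbolicCurveOrigin X →
      Ω.IsDLocOrigin DX → ∃ D : DLocSchemeData X, D.toDLocContext = DX)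
    (hcurve : ∀ (X : TemperedCurve p) (D : DLocSchemeData X) (Z : D.DLocK),
      Ω.IsHyperbolicCurveOrigin X → Ω.IsDLocOrigin D.toDLocContext →
        Ω.IsHyperbolicCurveOrigin (D.curve Z))
    (hL02 : ∀ (X : TemperedCurve p) (D : DLocSchemeData X), Ω.IsHyperbolicCurveOrigin X →
      Ω.IsDLocOrigin D.toDLocContext → ObjectsHitOnTheNose X D)
    (hL04 : ∀ (X : TemperedCurve p) (D : DLocSchemeData X), Ω.IsHyperbolicCurveOrigin X →
      Ω.IsDLocOrigin D.toDLocContext → PiFunctorBijectiveOnHom X D)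
    (hB4 : ∀ (X : TemperedCurve p) (D : DLocSchemeData X), Ω.IsHyperbolicCurveOrigin X →
      Ω.IsDLocOrigin D.toDLocContext → CuspImageOpenInDecomp X D)
    (hB1 : ∀ X : TemperedCurve p, Ω.IsHyperbolicCurveOrigin X → DecompCompact X)
    (h65 : Ω.CuspidalAbsolutenessHolds) (h65i : Ω.TemperedDecompositionGroupsHolds)
    (hΔ : ∀ X Y : TemperedCurve p, Ω.IsHyperbolicCurveOrigin X → Ω.IsHyperbolicCurveOrigin Y →
      ∀ α : X.PiTemp ≃ₜ* Y.PiTemp, X.DeltaTemp.map α.toMulEquiv.toMonoidHom = Y.DeltaTemp) :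
    Ω.DLocGroupTheoreticityHolds :=
  Ω.dlocGroupTheoreticityHolds_of_genuine hgen
    (Ω.dlocGroupTheoreticityGenuineHolds_of_parts hcurve hL02 hL04 hB4 hB1 h65 h65i hΔ)

/-! ### Thm. 6.8 (iii), first sentence, over the origin hypotheses -/

/-- **[SemiAnbd] Thm. 6.8 (iii), first sentence, for all CERTIFIED data, from the named leaves**
([Mzk8] proof of Cor. 2.6, p. 10): for an origin `Ω` such that every certified curve carries certified
genuine-morphism `DLoc_K` data ([Mzk8] Def. 2.1) whose objects' curves are certified, with T68i-L01
(coverings are objects), T68i-L04 (bijectivity on Hom-sets = Thm. 6.4 for pairs of objects), T68-B4,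
T68-B1, Thm. 6.5 (i)(ii)(iv) and (iii) as printed BY NAME, (hΔ), the `[n]`-object description of the
torsion closed points (T68iii-L04) for certified flags, and the flag coherence "the origin of a
once-punctured elliptic curve is a torsion closed point" — every isomorphism `α` of the tempered groups
of certified `X_K`, `Y_L` with certified arithmetic flags preserves the decomposition groups of the
torsion closed points (`TemperedCurve.IsoPreservesTorsionDecomp`).  Knit from
`Thm68Sub.isoPreservesTorsionDecomp_of` (sub-DAG row T68iii-A); nothing asserted.
[cite: MochizukiSemiAnbd2006, Thm 6.8(iii) p.75] [cite: MochizukiGalSect2005, Cor 2.6 p.10] -/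
theorem isoPreservesTorsionDecomp_of_parts (Ω : TemperedMorphismOrigin p)
    (hD : ∀ X : TemperedCurve p, Ω.IsHyperbolicCurveOrigin X →
      ∃ D : DLocSchemeData X, Ω.IsDLocOrigin D.toDLocContext)
    (hcurve : ∀ (X : TemperedCurve p) (D : DLocSchemeData X) (Z : D.DLocK),
      Ω.IsHyperbolicCurveOrigin X → Ω.IsDLocOrigin D.toDLocContext →
        Ω.IsHyperbolicCurveOrigin (D.curve Z))
    (hL01 : ∀ (X : TemperedCurve p) (D : DLocSchemeData X), Ω.IsHyperbolicCurveOrigin X →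
      Ω.IsDLocOrigin D.toDLocContext → CoveringObjectOfOpenSubgroup X D)
    (hL04 : ∀ (X : TemperedCurve p) (D : DLocSchemeData X), Ω.IsHyperbolicCurveOrigin X →
      Ω.IsDLocOrigin D.toDLocContext → PiFunctorBijectiveOnHom X D)
    (hB4 : ∀ (X : TemperedCurve p) (D : DLocSchemeData X), Ω.IsHyperbolicCurveOrigin X →
      Ω.IsDLocOrigin D.toDLocContext → CuspImageOpenInDecomp X D)
    (hB1 : ∀ X : TemperedCurve p, Ω.IsHyperbolicCurveOrigin X → DecompCompact X)
    (h65 : Ω.CuspidalAbsolutenessHolds) (h65i : Ω.TemperedDecompositionGroupsHolds)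
    (hΔ : ∀ X Y : TemperedCurve p, Ω.IsHyperbolicCurveOrigin X → Ω.IsHyperbolicCurveOrigin Y →
      ∀ α : X.PiTemp ≃ₜ* Y.PiTemp, X.DeltaTemp.map α.toMulEquiv.toMonoidHom = Y.DeltaTemp)
    (hT04 : ∀ (X : TemperedCurve p) (D : DLocSchemeData X) (a : TemperedCurve.CurveArithmeticFlags X),
      Ω.IsHyperbolicCurveOrigin X → Ω.IsDLocOrigin D.toDLocContext → Ω.IsFlagsOrigin a →
        TorsionIffMulNCuspImage X D a)
    (hcusp : ∀ (X : TemperedCurve p) (a : TemperedCurve.CurveArithmeticFlags X),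
      Ω.IsHyperbolicCurveOrigin X → Ω.IsFlagsOrigin a → a.IsOncePuncturedElliptic →
        ∀ x : X.Pt, X.IsCusp x → a.IsTorsionPt x)
    (X Y : TemperedCurve p) (aX : TemperedCurve.CurveArithmeticFlags X)
    (aY : TemperedCurve.CurveArithmeticFlags Y) (hX : Ω.IsHyperbolicCurveOrigin X)
    (hY : Ω.IsHyperbolicCurveOrigin Y) (haX : Ω.IsFlagsOrigin aX) (haY : Ω.IsFlagsOrigin aY)
    (α : X.PiTemp ≃ₜ* Y.PiTemp) : X.IsoPreservesTorsionDecomp Y aX aY α := by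
  intro hEX hEY
  obtain ⟨DX, hDX⟩ := hD X hX
  obtain ⟨DY, hDY⟩ := hD Y hY
  exact isoPreservesTorsionDecomp_of DX DY aX aY α (hΔ X Y hX hY α) (h65 X Y hX hY) (h65 Y X hY hX)
    (fun Z Z' => h65 _ _ (hcurve X DX Z hX hDX) (hcurve Y DY Z' hY hDY))
    (fun Z' Z => h65 _ _ (hcurve Y DY Z' hY hDY) (hcurve X DX Z hX hDX))
    (full_and_faithful_of_bijectiveOnHom X DX (hL04 X DX hX hDX)).1
    (full_and_faithful_of_bijectiveOnHom Y DY (hL04 Y DY hY hDY)).1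
    (hL01 X DX hX hDX) (hL01 Y DY hY hDY) (hB4 X DX hX hDX) (hB4 Y DY hY hDY) (hB1 X hX) (hB1 Y hY)
    (h65i X hX).2.2.1 (h65i Y hY).2.2.1 (hT04 X DX aX hX hDX haX) (hT04 Y DY aY hY hDY haY)
    (hcusp X aX hX haX hEX) (hcusp Y aY hY haY hEY) hEX hEY

/-! ### Thm. 6.8 (iii), (iv), Cor. 6.9 over the origin hypotheses -/

/-- **[SemiAnbd] Thm. 6.8 (iii)(iv) and Cor. 6.9 as printed (`DecompositionPreservationHolds`, FACT-LIST
F-1682), REDUCED to named binders**: the torsion clause (iii) to the leaves of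
`isoPreservesTorsionDecomp_of_parts`; the "in particular" of (iv) (`DefinedOverNumberFieldIff`) to the
first sentence of (iv) and T68iv-L05 ([Mzk8] Cor. 2.8 "[or, equivalently: `X_K` has at least one
algebraic point]") for both curves, via `Thm68Sub.definedOverNumberFieldIff_of`; while the first
sentence of (iv) (`IsoPreservesAlgebraicDecomp`, sub-DAG node T68iv-A — [Mzk8] Cor. 2.8 via [Belyi],
open in the sub-DAG: reading question Q-iv) and Cor. 6.9 (`IsoPreservesAllDecompGenusZeroNF` — printed
proof the tempered analogue of [Mzk8] Lemma 3.1 / Cor. 3.2, [SemiAnbd] pp. 75–76, not typed) are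
carried VERBATIM as binders over the certified data.  Nothing of [SemiAnbd]/[Mzk8]/[Belyi] is asserted.
[cite: MochizukiSemiAnbd2006, Thm 6.8(iii)-(iv), Cor 6.9 p.75] [cite: MochizukiGalSect2005, Cor 2.6, Cor 2.8 pp.10-11] -/
theorem decompositionPreservationHolds_of_parts (Ω : TemperedMorphismOrigin p)
    (hD : ∀ X : TemperedCurve p, Ω.IsHyperbolicCurveOrigin X →
      ∃ D : DLocSchemeData X, Ω.IsDLocOrigin D.toDLocContext)
    (hcurve : ∀ (X : TemperedCurve p) (D : DLocSchemeData X) (Z : D.DLocK),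
      Ω.IsHyperbolicCurveOrigin X → Ω.IsDLocOrigin D.toDLocContext →
        Ω.IsHyperbolicCurveOrigin (D.curve Z))
    (hL01 : ∀ (X : TemperedCurve p) (D : DLocSchemeData X), Ω.IsHyperbolicCurveOrigin X →
      Ω.IsDLocOrigin D.toDLocContext → CoveringObjectOfOpenSubgroup X D)
    (hL04 : ∀ (X : TemperedCurve p) (D : DLocSchemeData X), Ω.IsHyperbolicCurveOrigin X →
      Ω.IsDLocOrigin D.toDLocContext → PiFunctorBijectiveOnHom X D)
    (hB4 : ∀ (X : TemperedCurve p) (D : DLocSchemeData X), Ω.IsHyperbolicCurveOrigin X →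
      Ω.IsDLocOrigin D.toDLocContext → CuspImageOpenInDecomp X D)
    (hB1 : ∀ X : TemperedCurve p, Ω.IsHyperbolicCurveOrigin X → DecompCompact X)
    (h65 : Ω.CuspidalAbsolutenessHolds) (h65i : Ω.TemperedDecompositionGroupsHolds)
    (hΔ : ∀ X Y : TemperedCurve p, Ω.IsHyperbolicCurveOrigin X → Ω.IsHyperbolicCurveOrigin Y →
      ∀ α : X.PiTemp ≃ₜ* Y.PiTemp, X.DeltaTemp.map α.toMulEquiv.toMonoidHom = Y.DeltaTemp)
    (hT04 : ∀ (X : TemperedCurve p) (D : DLocSchemeData X) (a : TemperedCurve.CurveArithmeticFlags X),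
      Ω.IsHyperbolicCurveOrigin X → Ω.IsDLocOrigin D.toDLocContext → Ω.IsFlagsOrigin a →
        TorsionIffMulNCuspImage X D a)
    (hcusp : ∀ (X : TemperedCurve p) (a : TemperedCurve.CurveArithmeticFlags X),
      Ω.IsHyperbolicCurveOrigin X → Ω.IsFlagsOrigin a → a.IsOncePuncturedElliptic →
        ∀ x : X.Pt, X.IsCusp x → a.IsTorsionPt x)
    (hL05 : ∀ (X : TemperedCurve p) (a : TemperedCurve.CurveArithmeticFlags X),
      Ω.IsHyperbolicCurveOrigin X → Ω.IsFlagsOrigin a → DefinedOverNFIffExistsAlgebraic X a)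
    (hIV : ∀ (X Y : TemperedCurve p) (aX : TemperedCurve.CurveArithmeticFlags X)
      (aY : TemperedCurve.CurveArithmeticFlags Y), Ω.IsHyperbolicCurveOrigin X →
      Ω.IsHyperbolicCurveOrigin Y → Ω.IsFlagsOrigin aX → Ω.IsFlagsOrigin aY →
        ∀ α : X.PiTemp ≃ₜ* Y.PiTemp, X.IsoPreservesAlgebraicDecomp Y aX aY α)
    (h69 : ∀ (X Y : TemperedCurve p) (aX : TemperedCurve.CurveArithmeticFlags X)
      (aY : TemperedCurve.CurveArithmeticFlags Y), Ω.IsHyperbolicCurveOrigin X →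
      Ω.IsHyperbolicCurveOrigin Y → Ω.IsFlagsOrigin aX → Ω.IsFlagsOrigin aY →
        ∀ α : X.PiTemp ≃ₜ* Y.PiTemp, X.IsoPreservesAllDecompGenusZeroNF Y aX aY α) :
    Ω.DecompositionPreservationHolds := by
  intro X Y aX aY hX hY haX haY
  refine ⟨definedOverNumberFieldIff_of X Y aX aY (hL05 X aX hX haX) (hL05 Y aY hY haY)
      (hIV X Y aX aY hX hY haX haY), fun α => ⟨?_, hIV X Y aX aY hX hY haX haY α,
        h69 X Y aX aY hX hY haX haY α⟩⟩
  exact Ω.isoPreservesTorsionDecomp_of_parts hD hcurve hL01 hL04 hB4 hB1 h65 h65i hΔ hT04 hcusp X Y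
    aX aY hX hY haX haY α

end TemperedMorphismOrigin

/-! ### Thm. 6.8 (iii), both sentences, over the torsion origin hypotheses -/

namespace TemperedTorsionOrigin

open Thm68Sub

/-- **[SemiAnbd] Thm. 6.8 (iii), both sentences, as printed (`TorsionPointsHolds`, FACT-LIST F-1730),
REDUCED to named binders**: the first sentence (decomposition groups of torsion closed points are
preserved) to the leaves of `TemperedMorphismOrigin.isoPreservesTorsionDecomp_of_parts` ([Mzk8] proof
of Cor. 2.6, p. 10); the second sentence — compatibility of the resulting bijection with the
isomorphism of Tate modules induced by `α` (`TemperedCurve.IsoTorsionBijectionTateCompatible`; printed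
proof "by considering the automorphisms of `Z_K` over [i.e., relative to `φ`] `X_K`, after possibly
enlarging `K`", [Mzk8] p. 10, which needs the `E[n]`-torsor structure on the torsion closed points = the
deck action of the `[n]`-covering on the cusps of `Z_K`, sub-DAG row T68iii-L07, NOT part of the
interface `TorsionPointData`) — is carried VERBATIM as a binder over the certified data.  Nothing of
[SemiAnbd]/[Mzk8] is asserted. [cite: MochizukiSemiAnbd2006, Thm 6.8(iii) p.75]
[cite: MochizukiGalSect2005, Cor 2.6 p.10] -/
theorem torsionPointsHolds_of_parts (Ω : TemperedTorsionOrigin p)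
    (hD : ∀ X : TemperedCurve p, Ω.IsHyperbolicCurveOrigin X →
      ∃ D : DLocSchemeData X, Ω.IsDLocOrigin D.toDLocContext)
    (hcurve : ∀ (X : TemperedCurve p) (D : DLocSchemeData X) (Z : D.DLocK),
      Ω.IsHyperbolicCurveOrigin X → Ω.IsDLocOrigin D.toDLocContext →
        Ω.IsHyperbolicCurveOrigin (D.curve Z))
    (hL01 : ∀ (X : TemperedCurve p) (D : DLocSchemeData X), Ω.IsHyperbolicCurveOrigin X →
      Ω.IsDLocOrigin D.toDLocContext → CoveringObjectOfOpenSubgroup X D)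
    (hL04 : ∀ (X : TemperedCurve p) (D : DLocSchemeData X), Ω.IsHyperbolicCurveOrigin X →
      Ω.IsDLocOrigin D.toDLocContext → PiFunctorBijectiveOnHom X D)
    (hB4 : ∀ (X : TemperedCurve p) (D : DLocSchemeData X), Ω.IsHyperbolicCurveOrigin X →
      Ω.IsDLocOrigin D.toDLocContext → CuspImageOpenInDecomp X D)
    (hB1 : ∀ X : TemperedCurve p, Ω.IsHyperbolicCurveOrigin X → DecompCompact X)
    (h65 : Ω.CuspidalAbsolutenessHolds) (h65i : Ω.TemperedDecompositionGroupsHolds)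
    (hΔ : ∀ X Y : TemperedCurve p, Ω.IsHyperbolicCurveOrigin X → Ω.IsHyperbolicCurveOrigin Y →
      ∀ α : X.PiTemp ≃ₜ* Y.PiTemp, X.DeltaTemp.map α.toMulEquiv.toMonoidHom = Y.DeltaTemp)
    (hT04 : ∀ (X : TemperedCurve p) (D : DLocSchemeData X) (a : TemperedCurve.CurveArithmeticFlags X),
      Ω.IsHyperbolicCurveOrigin X → Ω.IsDLocOrigin D.toDLocContext → Ω.IsFlagsOrigin a →
        TorsionIffMulNCuspImage X D a)
    (hcusp : ∀ (X : TemperedCurve p) (a : TemperedCurve.CurveArithmeticFlags X),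
      Ω.IsHyperbolicCurveOrigin X → Ω.IsFlagsOrigin a → a.IsOncePuncturedElliptic →
        ∀ x : X.Pt, X.IsCusp x → a.IsTorsionPt x)
    (hTate : ∀ (X Y : TemperedCurve p) (aX : TemperedCurve.CurveArithmeticFlags X)
      (aY : TemperedCurve.CurveArithmeticFlags Y) (TX : TemperedCurve.TorsionPointData X aX)
      (TY : TemperedCurve.TorsionPointData Y aY), Ω.IsHyperbolicCurveOrigin X →
      Ω.IsHyperbolicCurveOrigin Y → Ω.IsFlagsOrigin aX → Ω.IsFlagsOrigin aY →
      Ω.IsTorsionPtOrigin TX → Ω.IsTorsionPtOrigin TY →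
        ∀ α : X.PiTemp ≃ₜ* Y.PiTemp, X.IsoTorsionBijectionTateCompatible Y aX aY TX TY α) :
    Ω.TorsionPointsHolds := by
  intro X Y aX aY TX TY hX hY haX haY hTX hTY α
  exact ⟨Ω.toTemperedMorphismOrigin.isoPreservesTorsionDecomp_of_parts hD hcurve hL01 hL04 hB4 hB1
      h65 h65i hΔ hT04 hcusp X Y aX aY hX hY haX haY α,
    hTate X Y aX aY TX TY hX hY haX haY hTX hTY α⟩

end TemperedTorsionOrigin

end Literature.AnabelianGeometry.SemiGraphs

end
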